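import Summits.Ventures.CertifiedManyBodySolver.Rows.DopedTLCorrBoxWindow
import Summits.Ventures.CertifiedManyBodySolver.Downfold.BoxesLa214V115M2cBoxRead
import HarnessLib

/-!
# Two-vertex BUNDLE rows of the `t–t'` square lattice read DENSITY-AFFINELY (`WN`): the claim-node SHAPE of a
# pinned / free `boxdual` segment read carrying its two vertex filling slopes, and the THICK box window row it yields
# (cell `pub/hubbard-obs`, D-0154 (1)(C) COVERAGE; captain ruling C-S1 (5) «S3 density … or WN rows if they suffice —
# box-1's call», CALLED 2026-08-28: the `n`-extent of every closing cell is carried by the families' own filling multipliers)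

HONEST FRAMING: first certified bounds on stiffness CEILINGS of CONTROL / CALIBRATION class on downfolded boxes; not a
superconductivity verdict. NOTHING IS ASSERTED HERE: every bound-valued statement is a `def … : Prop` or takes row predicates as
hypotheses; no `sorry`, no named fact, zero compute. Seat `hubbard-cov-hg1201-box-1` (`prover-hubbard-cov-hg1201-box-1-g0-0`;
KEY «…-box-1…2 = window typing + boxdual/0 exact reader per corner, claim nodes»). Companion of
`Rows/DopedTLCorrFilling.lean` (hubbard-downfold unc-2: ONE certificate read at every density, `SquareTTPrimeCorrOrbitLowerRowWN`),
`Rows/DopedTLCorrBoxWindow.lean` (hubbard-algo box-eng-3: the windowed BOX row `SquareTTPrimeCorrOrbitLowerBoxRowW lo hi flo cap r …`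
that the Hg-1201 strip closers `Theorems/CovHg1201M19bStripClosers.lean` consume) and `Downfold/BoxesLa214V115M2cBoxRead.lean`
(hubbard-cov-la214-box-2: the density-affine bundle VALUE `wnBundleValue F sl₁ sl₂ n₀ x = F + min(sl₁·(x − n₀), sl₂·(x − n₀))`, its
price-from-the-ends lemma, and the `t′`-bundle edition with CONSTANT window rows used by M2(c)).

WHY. A two-vertex bundle (a PINNED pair {hub, spoke′} or a free pair) over a segment of couplings — a `U`-segment at fixed `t′`
(Hg-1201 K1 left edge «PIN-HG-U/U′») or a `t′`-segment at fixed `U` (K2 bottom «PIN-HG-B») — is solved and read at ONE density `n₀`.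
The material box has a density EXTENT (`n ∈ [179/200, 183/200]` after the kinematic cut). The density enters the parent word
program ONLY through the right-hand sides `x/2` of its two `expect` equality rows, so along the interpolated dual family
`y(w) = (1−w)·y_hub + w·y_spoke` feasibility is untouched when `x` moves and the bound moves by `((1−w)·sl_hub + w·sl_spoke)·(x − n₀)`,
`sl_v = ½(λ₀ + λ₁)_v` the vertex filling slopes (weak duality, [BoydVandenberghe2004] §5.9; BOXDUAL-FORMAT.md READER NOTE «the
n-direction is carried by the row's own filling multipliers»): uniformly in `w`, the family certifies `wnBundleValue F0 sl_hub sl_spoke n₀ x`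
at density `x` under its own window rows — which, unlike M2(c)'s, are AFFINE FUNCTIONS of the bundle parameter here (the Hg legs carry
`U`-affine Hartree–Fock cap planes / `s`-affine strip rows). This file types

* §A the SHAPE `SquareTTPrimeBundleOrbitLowerRowWN U₁ U₂ s₁ s₂ flo cap F sl₁ sl₂ n₀ S Λ X`: parameter rectangle
  `U ∈ [U₁, U₂]`, `t′ ∈ [s₁, s₂]` (a bundle is the degenerate case `U₁ = U₂` or `s₁ = s₂`), window FUNCTIONS `flo cap : ℝ → ℝ → ℝ` of
  `(U, t′)`, value `wnBundleValue F sl₁ sl₂ n₀ x` at EVERY density `x ∈ [0, 2)`; READER CONTRACT (what the pinned-pair / light read prints,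
  exact ℚ): `F` (= F0, the uniform floor of the family bound at `n₀`), `sl₁`, `sl₂` (the two vertex filling slopes), the vertex window
  literals (⇒ the affine `flo`, `cap`), `n₀`, bundle / cert sha256;
* §B the solver-free edges: slot and window monotonicity; the shape at `x = n₀` is the plain value `F`;
* §C **SHAPE ⇒ THICK BOX WINDOW ROW**: on `Set.Icc ![U₁, s₁, n₁] ![U₂, s₂, n₂]` (`0 ≤ n₁`, `n₂ < 2`) the shape IS box-eng-3's
  `SquareTTPrimeCorrOrbitLowerBoxRowW … (fun θ ↦ flo (θ 0) (θ 1)) (fun θ ↦ cap (θ 0) (θ 1)) r S Λ X` for every rational slot `r` below the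
  four END values `F + sl_j·(n_e − n₀)` (`wnBundleValue` is concave piecewise-affine in `x`) — literally the `hrow` hypothesis of the
  Hg-1201 strip closers, with the density extent paid by four rational inequalities and NO density-extent cell read.

WHAT THIS IS NOT: a transport in `U` or `t′` (that is the pinned-pair / boxdual read itself, whose output the shape records); a claim that
any read has printed; a number. Instances live under `Certificates/` (claim nodes) and `Theorems/CovHg1201M19b*` (closers).

References: S. Boyd, L. Vandenberghe, *Convex Optimization* (2004) §5.9 [BoydVandenberghe2004]; J. Wang et al., PRX 14 (2024) 031006,
§III [WangEtAl2024]; R. B. Israel, *Convexity in the Theory of Lattice Gases* (1979) Thm. I.3.4 [Israel1979].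
-/

noncomputable section

namespace Summit.Ventures.CertifiedManyBodySolver

open Literature.MathematicalPhysics.QuantumLattice
open Matrix HubbardWave0 Literature.Probability.LatticeModels ThermodynamicLimit Filter Topology
open Summit.Ventures.CertifiedManyBodySolver.Downfold (wnBundleValue wnBundleValue_self neg_wnBundleValue_le_of_ends)
open scoped BigOperators ComplexOrder

/-! ## §A  The density-affine two-vertex bundle row SHAPE (functional window, router order `(U, t′)`) -/

section Defs

/-- §A **BUNDLE-WN ROW SHAPE** `SquareTTPrimeBundleOrbitLowerRowWN U₁ U₂ s₁ s₂ flo cap F sl₁ sl₂ n₀ S Λ X`. Square lattice `ℤ²`, `t = 1`;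
parameter rectangle `U ∈ [U₁, U₂]`, `t′ ∈ [s₁, s₂]`; window functions `flo cap` of `(U, t′)`; a two-vertex bundle solved at density `n₀` with
uniform floor `F` and vertex filling slopes `sl₁`, `sl₂`: for EVERY `(U, s)` of the rectangle, EVERY density `x ∈ [0, 2)` and every torus limit
`ω` of unit ground states `ψ` of the sectors `(rectN x L_j, S^z = 0)` of `hubbardTorusTT' L_j 1 s U` along `L_j → ∞`, GIVEN the family's window
rows `flo U s ≤ e₀(1, s, U, x) ≤ cap U s`: `wnBundleValue F sl₁ sl₂ n₀ x ≤ |S|⁻¹ Σ_{γ ∈ S} Re ω_{γΛ}(Γ(d4Emb γ 0) X)`.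
[cite: BoydVandenberghe2004, §5.9] -/
def SquareTTPrimeBundleOrbitLowerRowWN (U₁ U₂ s₁ s₂ : ℝ) (flo cap : ℝ → ℝ → ℝ) (F sl₁ sl₂ n₀ : ℚ)
    (S : Finset (DihedralGroup 4)) (Λ : Finset (Site 2)) (X : FermionOp Λ) : Prop :=
  ∀ U ∈ Set.Icc U₁ U₂, ∀ s ∈ Set.Icc s₁ s₂, ∀ x : ℝ, 0 ≤ x → x < 2 →
    ∀ (ω : InfVolFermionState 2) (Ls : ℕ → ℕ) (ψ : ∀ L, Fock (Orb (FermionTorus 2 L))),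
      Tendsto Ls atTop atTop →
      (∀ j, IsGroundStateInSector (hubbardTorusTT' (Ls j) 1 s U) (rectN x (Ls j)) 0 (ψ (Ls j))) →
      (∀ j, star (ψ (Ls j)) ⬝ᵥ ψ (Ls j) = 1) → ω.IsTorusLimitOf ψ Ls →
      flo U s ≤ energyDensityTT' 1 s U x → energyDensityTT' 1 s U x ≤ cap U s →
      wnBundleValue F sl₁ sl₂ n₀ x ≤
        (S.card : ℝ)⁻¹ * ∑ g ∈ S, (ω.expect (d4ShiftSet g 0 Λ) (fermionEmbed (PolySite.d4Emb g 0 Λ) X)).re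

end Defs

/-! ## §B  Solver-free edges -/

section Edges

variable {U₁ U₂ s₁ s₂ : ℝ} {flo cap flo' cap' : ℝ → ℝ → ℝ} {F F' sl₁ sl₂ n₀ : ℚ} {S : Finset (DihedralGroup 4)}
  {Λ : Finset (Site 2)} {X : FermionOp Λ}

/-- Slot monotonicity: the shape survives any SMALLER floor value `F' ≤ F` (same slopes). [folklore] -/
theorem SquareTTPrimeBundleOrbitLowerRowWN.mono
    (h : SquareTTPrimeBundleOrbitLowerRowWN U₁ U₂ s₁ s₂ flo cap F sl₁ sl₂ n₀ S Λ X) (hF : F' ≤ F) :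
    SquareTTPrimeBundleOrbitLowerRowWN U₁ U₂ s₁ s₂ flo cap F' sl₁ sl₂ n₀ S Λ X := by
  intro U hU s hs x hx0 hx2 ω Ls ψ hLs hψ hψ1 hω hl hu
  have hh := h U hU s hs x hx0 hx2 ω Ls ψ hLs hψ hψ1 hω hl hu
  have hF' : ((F' : ℚ) : ℝ) ≤ ((F : ℚ) : ℝ) := by exact_mod_cast hF
  unfold wnBundleValue at hh ⊢
  linarith

/-- Window monotonicity: the shape survives any NARROWER window on a SUB-rectangle (HIGHER floor, LOWER cap — fewer states qualify).
[folklore] -/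
theorem SquareTTPrimeBundleOrbitLowerRowWN.mono_window {U₁' U₂' s₁' s₂' : ℝ}
    (h : SquareTTPrimeBundleOrbitLowerRowWN U₁ U₂ s₁ s₂ flo cap F sl₁ sl₂ n₀ S Λ X)
    (hU₁ : U₁ ≤ U₁') (hU₂ : U₂' ≤ U₂) (hs₁ : s₁ ≤ s₁') (hs₂ : s₂' ≤ s₂)
    (hflo : ∀ U ∈ Set.Icc U₁' U₂', ∀ s ∈ Set.Icc s₁' s₂', flo U s ≤ flo' U s)
    (hcap : ∀ U ∈ Set.Icc U₁' U₂', ∀ s ∈ Set.Icc s₁' s₂', cap' U s ≤ cap U s) :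
    SquareTTPrimeBundleOrbitLowerRowWN U₁' U₂' s₁' s₂' flo' cap' F sl₁ sl₂ n₀ S Λ X :=
  fun U hU s hs x hx0 hx2 ω Ls ψ hLs hψ hψ1 hω hl hu =>
    h U ⟨hU₁.trans hU.1, hU.2.trans hU₂⟩ s ⟨hs₁.trans hs.1, hs.2.trans hs₂⟩ x hx0 hx2 ω Ls ψ hLs hψ hψ1 hω
      ((hflo U hU s hs).trans hl) (hu.trans (hcap U hU s hs))

/-- At the solve density `x = n₀` the shape gives the plain value `F`. [folklore] -/
theorem SquareTTPrimeBundleOrbitLowerRowWN.at_anchor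
    (h : SquareTTPrimeBundleOrbitLowerRowWN U₁ U₂ s₁ s₂ flo cap F sl₁ sl₂ n₀ S Λ X) (hn0 : 0 ≤ n₀) (hn2 : n₀ < 2) :
    ∀ U ∈ Set.Icc U₁ U₂, ∀ s ∈ Set.Icc s₁ s₂,
      ∀ (ω : InfVolFermionState 2) (Ls : ℕ → ℕ) (ψ : ∀ L, Fock (Orb (FermionTorus 2 L))),
      Tendsto Ls atTop atTop →
      (∀ j, IsGroundStateInSector (hubbardTorusTT' (Ls j) 1 s U) (rectN ((n₀ : ℚ) : ℝ) (Ls j)) 0 (ψ (Ls j))) →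
      (∀ j, star (ψ (Ls j)) ⬝ᵥ ψ (Ls j) = 1) → ω.IsTorusLimitOf ψ Ls →
      flo U s ≤ energyDensityTT' 1 s U ((n₀ : ℚ) : ℝ) → energyDensityTT' 1 s U ((n₀ : ℚ) : ℝ) ≤ cap U s →
      ((F : ℚ) : ℝ) ≤ (S.card : ℝ)⁻¹ * ∑ g ∈ S, (ω.expect (d4ShiftSet g 0 Λ) (fermionEmbed (PolySite.d4Emb g 0 Λ) X)).re := by
  intro U hU s hs ω Ls ψ hLs hψ hψ1 hω hl hu
  have hh := h U hU s hs ((n₀ : ℚ) : ℝ) (by exact_mod_cast hn0) (by exact_mod_cast hn2) ω Ls ψ hLs hψ hψ1 hω hl hu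
  rwa [wnBundleValue_self] at hh

/-- **The value between the ends.** `wnBundleValue F sl₁ sl₂ n₀ ·` is concave piecewise-affine in the density, so on `[n₁, n₂]` it is at least
any `r` below its four affine END values `F + sl_j·(n_e − n₀)`. [cite: Israel1979, Thm. I.3.4] -/
theorem le_wnBundleValue_of_ends {r : ℚ} {n₁ n₂ x : ℝ} (hx₁ : n₁ ≤ x) (hx₂ : x ≤ n₂)
    (h₁₁ : ((r : ℚ) : ℝ) ≤ ((F : ℚ) : ℝ) + ((sl₁ : ℚ) : ℝ) * (n₁ - ((n₀ : ℚ) : ℝ)))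
    (h₁₂ : ((r : ℚ) : ℝ) ≤ ((F : ℚ) : ℝ) + ((sl₁ : ℚ) : ℝ) * (n₂ - ((n₀ : ℚ) : ℝ)))
    (h₂₁ : ((r : ℚ) : ℝ) ≤ ((F : ℚ) : ℝ) + ((sl₂ : ℚ) : ℝ) * (n₁ - ((n₀ : ℚ) : ℝ)))
    (h₂₂ : ((r : ℚ) : ℝ) ≤ ((F : ℚ) : ℝ) + ((sl₂ : ℚ) : ℝ) * (n₂ - ((n₀ : ℚ) : ℝ))) :
    ((r : ℚ) : ℝ) ≤ wnBundleValue F sl₁ sl₂ n₀ x := by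
  have h := neg_wnBundleValue_le_of_ends (F := F) (sl₁ := sl₁) (sl₂ := sl₂) (n₀ := n₀) (c := -r) hx₁ hx₂
    (by push_cast; linarith) (by push_cast; linarith) (by push_cast; linarith) (by push_cast; linarith)
  push_cast at h
  linarith

end Edges

/-! ## §C  SHAPE ⇒ the THICK box window row (density extent paid by the four end values) -/

section Thick

variable {U₁ U₂ s₁ s₂ : ℝ} {flo cap : ℝ → ℝ → ℝ} {F sl₁ sl₂ n₀ : ℚ} {S : Finset (DihedralGroup 4)}
  {Λ : Finset (Site 2)} {X : FermionOp Λ}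

/-- Membership in the thick cell `Set.Icc ![U₁, s₁, n₁] ![U₂, s₂, n₂]`, coordinate by coordinate. [folklore] -/
theorem mem_thickCell_vec3 {U₁ U₂ s₁ s₂ n₁ n₂ : ℝ} {θ : Fin 3 → ℝ} (hθ : θ ∈ Set.Icc ![U₁, s₁, n₁] ![U₂, s₂, n₂]) :
    (U₁ ≤ θ 0 ∧ θ 0 ≤ U₂) ∧ (s₁ ≤ θ 1 ∧ θ 1 ≤ s₂) ∧ (n₁ ≤ θ 2 ∧ θ 2 ≤ n₂) := by
  rw [Set.mem_Icc, Pi.le_def, Pi.le_def, Fin.forall_fin_succ, Fin.forall_fin_succ, Fin.forall_fin_one,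
    Fin.forall_fin_succ, Fin.forall_fin_succ, Fin.forall_fin_one] at hθ
  simp only [Matrix.cons_val_zero, Fin.succ_zero_eq_one, Fin.succ_one_eq_two] at hθ
  obtain ⟨⟨h0, h1, h2⟩, ⟨h0', h1', h2'⟩⟩ := hθ
  exact ⟨⟨by simpa using h0, by simpa using h0'⟩, ⟨by simpa using h1, by simpa using h1'⟩, ⟨by simpa using h2, by simpa using h2'⟩⟩

/-- **BUNDLE-WN SHAPE ⇒ THICK BOX WINDOW ROW.** `0 ≤ n₁`, `n₂ < 2`, and a rational slot `r` below the four end values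
`F + sl_j·(n_e − n₀)` (`j, e ∈ {1, 2}`): then `SquareTTPrimeCorrOrbitLowerBoxRowW ![U₁, s₁, n₁] ![U₂, s₂, n₂] (fun θ ↦ flo (θ 0) (θ 1))
(fun θ ↦ cap (θ 0) (θ 1)) r S Λ X` — the windowed box row of `Rows/DopedTLCorrBoxWindow.lean` on the THICK cell (parameter rectangle × density extent),
its window functions the family's own (density-blind) row functions. The density extent costs NO read: it is the family's filling multipliers.
[cite: BoydVandenberghe2004, §5.9] [cite: WangEtAl2024, §III] -/
theorem SquareTTPrimeBundleOrbitLowerRowWN.orbitLowerBoxRowW_thick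
    (h : SquareTTPrimeBundleOrbitLowerRowWN U₁ U₂ s₁ s₂ flo cap F sl₁ sl₂ n₀ S Λ X) {n₁ n₂ : ℝ} (hn₁ : 0 ≤ n₁) (hn₂ : n₂ < 2)
    {r : ℚ}
    (h₁₁ : ((r : ℚ) : ℝ) ≤ ((F : ℚ) : ℝ) + ((sl₁ : ℚ) : ℝ) * (n₁ - ((n₀ : ℚ) : ℝ)))
    (h₁₂ : ((r : ℚ) : ℝ) ≤ ((F : ℚ) : ℝ) + ((sl₁ : ℚ) : ℝ) * (n₂ - ((n₀ : ℚ) : ℝ)))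
    (h₂₁ : ((r : ℚ) : ℝ) ≤ ((F : ℚ) : ℝ) + ((sl₂ : ℚ) : ℝ) * (n₁ - ((n₀ : ℚ) : ℝ)))
    (h₂₂ : ((r : ℚ) : ℝ) ≤ ((F : ℚ) : ℝ) + ((sl₂ : ℚ) : ℝ) * (n₂ - ((n₀ : ℚ) : ℝ))) :
    SquareTTPrimeCorrOrbitLowerBoxRowW ![U₁, s₁, n₁] ![U₂, s₂, n₂] (fun θ => flo (θ 0) (θ 1)) (fun θ => cap (θ 0) (θ 1))
      r S Λ X := by
  intro θ hθ ω Ls ψ hLs hψ hψ1 hω hl hu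
  obtain ⟨⟨h0, h0'⟩, ⟨h1, h1'⟩, ⟨h2, h2'⟩⟩ := mem_thickCell_vec3 hθ
  have hrow := h (θ 0) ⟨h0, h0'⟩ (θ 1) ⟨h1, h1'⟩ (θ 2) (hn₁.trans h2) (lt_of_le_of_lt h2' hn₂) ω Ls ψ hLs hψ hψ1 hω hl hu
  exact (le_wnBundleValue_of_ends h2 h2' h₁₁ h₁₂ h₂₁ h₂₂).trans hrow

/-- **The same with RATIONAL density ends** (`n₁ n₂ : ℚ`, the four prices as rational inequalities — decidable by `norm_num` at every instance).
[cite: BoydVandenberghe2004, §5.9] -/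
theorem SquareTTPrimeBundleOrbitLowerRowWN.orbitLowerBoxRowW_thick_rat
    (h : SquareTTPrimeBundleOrbitLowerRowWN U₁ U₂ s₁ s₂ flo cap F sl₁ sl₂ n₀ S Λ X) {n₁ n₂ : ℚ} (hn₁ : 0 ≤ n₁) (hn₂ : n₂ < 2)
    {r : ℚ} (h₁₁ : r ≤ F + sl₁ * (n₁ - n₀)) (h₁₂ : r ≤ F + sl₁ * (n₂ - n₀)) (h₂₁ : r ≤ F + sl₂ * (n₁ - n₀))
    (h₂₂ : r ≤ F + sl₂ * (n₂ - n₀)) :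
    SquareTTPrimeCorrOrbitLowerBoxRowW ![U₁, s₁, ((n₁ : ℚ) : ℝ)] ![U₂, s₂, ((n₂ : ℚ) : ℝ)] (fun θ => flo (θ 0) (θ 1))
      (fun θ => cap (θ 0) (θ 1)) r S Λ X :=
  h.orbitLowerBoxRowW_thick (by exact_mod_cast hn₁) (by exact_mod_cast hn₂) (by exact_mod_cast h₁₁) (by exact_mod_cast h₁₂)
    (by exact_mod_cast h₂₁) (by exact_mod_cast h₂₂)

/-- **At ONE density `x ∈ [0, 2)` the shape is the (density-degenerate) box window row with slot `r ≤ wnBundleValue … x`'s two branches**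
— the edition a read WITHOUT density extent would have produced (`n₁ = n₂ = x`). [cite: WangEtAl2024, §III] -/
theorem SquareTTPrimeBundleOrbitLowerRowWN.orbitLowerBoxRowW_at
    (h : SquareTTPrimeBundleOrbitLowerRowWN U₁ U₂ s₁ s₂ flo cap F sl₁ sl₂ n₀ S Λ X) {x : ℝ} (hx0 : 0 ≤ x) (hx2 : x < 2)
    {r : ℚ} (h₁ : ((r : ℚ) : ℝ) ≤ ((F : ℚ) : ℝ) + ((sl₁ : ℚ) : ℝ) * (x - ((n₀ : ℚ) : ℝ)))
    (h₂ : ((r : ℚ) : ℝ) ≤ ((F : ℚ) : ℝ) + ((sl₂ : ℚ) : ℝ) * (x - ((n₀ : ℚ) : ℝ))) :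
    SquareTTPrimeCorrOrbitLowerBoxRowW ![U₁, s₁, x] ![U₂, s₂, x] (fun θ => flo (θ 0) (θ 1)) (fun θ => cap (θ 0) (θ 1))
      r S Λ X :=
  h.orbitLowerBoxRowW_thick hx0 hx2 h₁ h₁ h₂ h₂

end Thick

end Summit.Ventures.CertifiedManyBodySolver

end
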